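import Mathlib.Analysis.InnerProductSpace.Adjoint
import Mathlib.Analysis.InnerProductSpace.Rayleigh
import Mathlib.Topology.Algebra.Module.Basic
import HarnessLib

/-!
# The min–max level over a dense subspace bounds a positive operator on the orthocomplement
# of a top eigenvector (Courant–Fischer / Reed–Simon IV, Thm XIII.1, level 1) — PROVED

Topic `Literature/Analysis/OperatorTheory` (next to `PositivityImprovingSpectralGap`, whose
`norm_pow_apply_sub_le_of_gap` consumes exactly the bound proved here). Setting: a bounded
self-adjoint operator `T` on a Hilbert space `G` over `𝕜 = ℝ` or `ℂ` with
`0 ≤ re ⟪x, T x⟫ ≤ λ₀ ‖x‖²`, a unit vector `Ω` with `T Ω = λ₀ Ω`, and a dense subspace `D`.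
The *second min–max level over `D`* is

  `λ₁(D) = inf_{φ ∈ D} sup { re ⟪ψ, T ψ⟫ / ‖ψ‖² : ψ ∈ D, ψ ≠ 0, ⟪φ, ψ⟫ = 0 }`

(real `sInf` / `sSup`; every set involved is bounded, the Rayleigh quotient taking values in
`[0, λ₀]`). The main result `norm_apply_le_secondLevel_of_dense` is the honest direction of the
min–max principle WITHOUT compactness: `‖T w‖ ≤ λ₁(D) ‖w‖` for every `w ⊥ Ω`. Steps:

* `inner_apply_eq_zero_of_apply_eq_smul` — `Ω^⊥` is `T`-invariant;
* `norm_apply_le_of_re_inner_le` — for a positive symmetric `T`, the two quadratic-form bounds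
  `re ⟪w, T w⟫ ≤ L ‖w‖²`, `re ⟪T w, T (T w)⟫ ≤ L ‖T w‖²` already give `‖T w‖ ≤ L ‖w‖`
  (discriminant of `c ↦ re ⟪T w - c w, T (T w - c w)⟫ ≥ 0`);
* `exists_trial_vector_of_inner_eq_zero` — for `x ⊥ Ω`, `x ≠ 0` and any `φ`, the plane
  `span {Ω, x}` contains `ψ ≠ 0` with `ψ ⊥ φ` and Rayleigh quotient `≥` that of `x`
  (`re ⟪aΩ + bx, T (aΩ + bx)⟫ = |a|² λ₀ + |b|² re ⟪x, T x⟫` and `λ₀ ≥` every Rayleigh quotient);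
* `exists_mem_rayleigh_gt` — `D ∩ φ^⊥` is dense in `φ^⊥` when `φ ∈ D` (project along `φ`), and
  the Rayleigh quotient is continuous away from `0`;
* `re_inner_le_secondLevel_mul` — hence `re ⟪x, T x⟫ ≤ λ₁(D) ‖x‖²` on `Ω^⊥`;
* `norm_apply_le_secondLevel_of_dense` (**main**).

Printed source: Reed–Simon IV, §XIII.1, Thm XIII.1 (the min–max principle; the trial vectors
may be taken in any form core, here the dense subspace `D`) [`ReedSimonIV1978`]. What is NOT
here: the reverse inequality / attainment (`λ₁(D)` is an eigenvalue when `T` is compact), and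
the existence of the top eigenvector `Ω` (an input).
-/

noncomputable section

open Filter Topology
open scoped InnerProductSpace

namespace Literature.Analysis.OperatorTheory

section Helpers

variable {𝕜 : Type*} [RCLike 𝕜] {G : Type*} [NormedAddCommGroup G] [InnerProductSpace 𝕜 G]

/-- **`Ω^⊥` is invariant** under a symmetric operator with `T Ω = c Ω`:
`⟪Ω, T w⟫ = ⟪T Ω, w⟫ = conj c ⟪Ω, w⟫ = 0`. [folklore] -/
theorem inner_apply_eq_zero_of_apply_eq_smul {T : G →L[𝕜] G}
    (hT : (T : G →ₗ[𝕜] G).IsSymmetric) {Ω : G} {c : 𝕜} (hTΩ : T Ω = c • Ω) {w : G}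
    (hw : ⟪Ω, w⟫_𝕜 = 0) : ⟪Ω, T w⟫_𝕜 = 0 := by
  rw [← hT.apply_clm, hTΩ, inner_smul_left, hw, mul_zero]

/-- **Quadratic-form bounds at `w` and `T w` give a norm bound.** For a symmetric `T` with
`0 ≤ re ⟪x, T x⟫` for all `x`, if `re ⟪w, T w⟫ ≤ L ‖w‖²` and `re ⟪T w, T (T w)⟫ ≤ L ‖T w‖²`
then `‖T w‖ ≤ L ‖w‖` (expand `0 ≤ re ⟪T w - c w, T (T w - c w)⟫ = re ⟪Tw, TTw⟫ - 2c ‖Tw‖²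
+ c² re ⟪w, Tw⟫` at `c = L` and `c = 1`; the generalised Cauchy–Schwarz inequality for the
positive form `⟪·, T ·⟫`). [folklore] -/
theorem norm_apply_le_of_re_inner_le {T : G →L[𝕜] G} (hT : (T : G →ₗ[𝕜] G).IsSymmetric)
    (hpos : ∀ x : G, 0 ≤ RCLike.re ⟪x, T x⟫_𝕜) {L : ℝ} {w : G}
    (hw : RCLike.re ⟪w, T w⟫_𝕜 ≤ L * ‖w‖ ^ 2)
    (hTw : RCLike.re ⟪T w, T (T w)⟫_𝕜 ≤ L * ‖T w‖ ^ 2) : ‖T w‖ ≤ L * ‖w‖ := by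
  -- the quadratic `c ↦ re ⟪T w - c w, T (T w - c w)⟫` is nonnegative
  have hq : ∀ c : ℝ, 0 ≤ L * ‖T w‖ ^ 2 - 2 * c * ‖T w‖ ^ 2 + c ^ 2 * (L * ‖w‖ ^ 2) := by
    intro c
    have h0 := hpos (T w - (c : 𝕜) • w)
    have h1 : RCLike.re ⟪T w, T w⟫_𝕜 = ‖T w‖ ^ 2 := inner_self_eq_norm_sq (𝕜 := 𝕜) (T w)
    have h2 : RCLike.re ⟪w, T (T w)⟫_𝕜 = ‖T w‖ ^ 2 := by rw [← hT.apply_clm, h1]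
    rw [map_sub, map_smul] at h0
    simp only [inner_sub_left, inner_sub_right, inner_smul_left, inner_smul_right,
      RCLike.conj_ofReal, map_sub, RCLike.re_ofReal_mul, h1, h2] at h0
    nlinarith [h0, mul_nonneg (sq_nonneg c) (sub_nonneg.mpr hw), hTw]
  rcases eq_or_ne w 0 with rfl | hw0
  · simp
  have hB : 0 < ‖w‖ ^ 2 := by positivity
  have hL : 0 ≤ L := by
    have h := (hpos w).trans hw
    nlinarith [h, hB]
  rcases hL.eq_or_lt with rfl | hLpos
  · -- `L = 0`: the quadratic at `c = 1` forces `T w = 0`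
    have h := hq 1
    have hA : ‖T w‖ ^ 2 ≤ 0 := by nlinarith [h]
    have : ‖T w‖ = 0 := by nlinarith [hA, norm_nonneg (T w)]
    rw [this, zero_mul]
  · -- `L > 0`: the quadratic at `c = L`
    have h := hq L
    have hA : ‖T w‖ ^ 2 ≤ (L * ‖w‖) ^ 2 := by
      have : 0 ≤ L * ((L * ‖w‖) ^ 2 - ‖T w‖ ^ 2) := by nlinarith [h]
      nlinarith [this, hLpos, (mul_nonneg_iff_of_pos_left hLpos).mp this]
    exact (sq_le_sq₀ (norm_nonneg _) (by positivity)).mp hA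

/-- **Two-dimensional trial vector.** Let `T` be symmetric with every Rayleigh quotient `≤ λ₀`,
`‖Ω‖ = 1`, `T Ω = λ₀ Ω`, and `x ⊥ Ω`, `x ≠ 0`. For any `φ` the plane `span {Ω, x}` contains
`ψ ≠ 0` with `ψ ⊥ φ` whose Rayleigh quotient is at least that of `x`: with `ψ = a Ω + b x`,
`‖ψ‖² = |a|² + |b|² ‖x‖²` and `re ⟪ψ, T ψ⟫ = |a|² λ₀ + |b|² re ⟪x, T x⟫` (the cross terms vanish
because `Ω^⊥` is invariant), and `λ₀ ‖x‖² ≥ re ⟪x, T x⟫`. (Reed–Simon IV, proof of Thm XIII.1: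
a `2`-dimensional space meets the `1`-codimensional constraint.) [folklore] -/
theorem exists_trial_vector_of_inner_eq_zero {T : G →L[𝕜] G}
    (hT : (T : G →ₗ[𝕜] G).IsSymmetric) {lam₀ : ℝ}
    (hle : ∀ x : G, RCLike.re ⟪x, T x⟫_𝕜 ≤ lam₀ * ‖x‖ ^ 2) {Ω : G} (hΩ : ‖Ω‖ = 1)
    (hTΩ : T Ω = (lam₀ : 𝕜) • Ω) (φ : G) {x : G} (hx : ⟪Ω, x⟫_𝕜 = 0) (hx0 : x ≠ 0) :
    ∃ ψ : G, ψ ≠ 0 ∧ ⟪φ, ψ⟫_𝕜 = 0 ∧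
      RCLike.re ⟪x, T x⟫_𝕜 / ‖x‖ ^ 2 ≤ RCLike.re ⟪ψ, T ψ⟫_𝕜 / ‖ψ‖ ^ 2 := by
  by_cases hφx : ⟪φ, x⟫_𝕜 = 0
  · exact ⟨x, hx0, hφx, le_rfl⟩
  -- `ψ = ⟪φ, x⟫ Ω - ⟪φ, Ω⟫ x`
  set a : 𝕜 := ⟪φ, x⟫_𝕜 with ha
  set b : 𝕜 := -⟪φ, Ω⟫_𝕜 with hb
  have hΩΩ : ⟪Ω, Ω⟫_𝕜 = 1 := by
    rw [inner_self_eq_norm_sq_to_K, hΩ]; simp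
  have hxΩ : ⟪x, Ω⟫_𝕜 = 0 := inner_eq_zero_symm.mp hx
  have hΩTx : ⟪Ω, T x⟫_𝕜 = 0 := inner_apply_eq_zero_of_apply_eq_smul hT hTΩ hx
  refine ⟨a • Ω + b • x, ?_, ?_, ?_⟩
  · -- nonzero: its component along `Ω` is `a ≠ 0`
    intro h
    have h1 : ⟪Ω, a • Ω + b • x⟫_𝕜 = a := by
      rw [inner_add_right, inner_smul_right, inner_smul_right, hΩΩ, hx, mul_one, mul_zero,
        add_zero]
    rw [h, inner_zero_right] at h1
    exact hφx h1.symm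
  · -- orthogonal to `φ`
    rw [inner_add_right, inner_smul_right, inner_smul_right, hb, ← ha]
    ring
  · -- Rayleigh quotients
    have hn : ‖a • Ω + b • x‖ ^ 2 = ‖a‖ ^ 2 + ‖b‖ ^ 2 * ‖x‖ ^ 2 := by
      rw [@norm_add_sq 𝕜, inner_smul_left, inner_smul_right, hx, mul_zero, mul_zero, map_zero,
        mul_zero, add_zero, norm_smul, norm_smul, hΩ, mul_one, mul_pow]
    have hq : RCLike.re ⟪a • Ω + b • x, T (a • Ω + b • x)⟫_𝕜 =
        ‖a‖ ^ 2 * lam₀ + ‖b‖ ^ 2 * RCLike.re ⟪x, T x⟫_𝕜 := by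
      rw [map_add, map_smul, map_smul, hTΩ]
      simp only [inner_add_left, inner_add_right, inner_smul_left, inner_smul_right, hΩΩ, hxΩ,
        hΩTx, mul_zero, mul_one, add_zero, zero_add]
      simp only [map_add, RCLike.mul_re, RCLike.mul_im, RCLike.conj_re, RCLike.conj_im,
        RCLike.ofReal_re, RCLike.ofReal_im, RCLike.norm_sq_eq_def]
      ring
    have hB : 0 < ‖x‖ ^ 2 := by positivity
    have ha0 : 0 < ‖a‖ ^ 2 := by
      have : a ≠ 0 := hφx
      positivity
    have hden : 0 < ‖a‖ ^ 2 + ‖b‖ ^ 2 * ‖x‖ ^ 2 := by positivity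
    rw [hn, hq, div_le_div_iff₀ hB hden]
    nlinarith [mul_le_mul_of_nonneg_left (hle x) ha0.le]

/-- **`D ∩ φ^⊥` approximates `φ^⊥` in Rayleigh quotient** when `D` is a dense subspace
containing `φ`: if `ψ ≠ 0`, `ψ ⊥ φ` and `r < re ⟪ψ, T ψ⟫ / ‖ψ‖²`, there is `ψ' ∈ D`, `ψ' ≠ 0`,
`ψ' ⊥ φ` with `r < re ⟪ψ', T ψ'⟫ / ‖ψ'‖²` (the projection `d ↦ d - (⟪φ, d⟫ / ‖φ‖²) φ` along
`φ` maps `D` into `D ∩ φ^⊥`, fixes `ψ` and is continuous; the Rayleigh quotient is continuous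
at `ψ ≠ 0`). [folklore] -/
theorem exists_mem_rayleigh_gt (T : G →L[𝕜] G) {D : Submodule 𝕜 G} (hD : Dense (D : Set G))
    {φ : G} (hφ : φ ∈ D) {ψ : G} (hψ0 : ψ ≠ 0) (hφψ : ⟪φ, ψ⟫_𝕜 = 0) {r : ℝ}
    (hr : r < RCLike.re ⟪ψ, T ψ⟫_𝕜 / ‖ψ‖ ^ 2) :
    ∃ ψ' : G, ψ' ∈ D ∧ ψ' ≠ 0 ∧ ⟪φ, ψ'⟫_𝕜 = 0 ∧
      r < RCLike.re ⟪ψ', T ψ'⟫_𝕜 / ‖ψ'‖ ^ 2 := by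
  -- the projection along `φ`
  set P : G → G := fun d => d - (⟪φ, d⟫_𝕜 / ((‖φ‖ : 𝕜) ^ 2)) • φ with hP
  have hPc : Continuous P := by
    simp only [hP]
    fun_prop
  have hPψ : P ψ = ψ := by simp [hP, hφψ]
  have hPorth : ∀ d, ⟪φ, P d⟫_𝕜 = 0 := by
    intro d
    simp only [hP, inner_sub_right, inner_smul_right, inner_self_eq_norm_sq_to_K]
    by_cases hφ0 : φ = 0
    · simp [hφ0]
    · have : ((‖φ‖ : 𝕜) ^ 2) ≠ 0 := pow_ne_zero 2 (by exact_mod_cast norm_ne_zero_iff.mpr hφ0)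
      rw [div_mul_cancel₀ _ this, sub_self]
  have hPmem : ∀ d ∈ D, P d ∈ D := fun d hd => D.sub_mem hd (D.smul_mem _ hφ)
  -- continuity of the Rayleigh quotient at `ψ ≠ 0`
  have hR : ContinuousAt (fun y : G => RCLike.re ⟪y, T y⟫_𝕜 / ‖y‖ ^ 2) ψ := by
    refine ContinuousAt.div ?_ ?_ (pow_ne_zero 2 (norm_ne_zero_iff.mpr hψ0))
    · exact (RCLike.continuous_re.comp (continuous_id.inner T.continuous)).continuousAt
    · exact (continuous_norm.pow 2).continuousAt
  have h1 : ∀ᶠ y in 𝓝 ψ, r < RCLike.re ⟪y, T y⟫_𝕜 / ‖y‖ ^ 2 :=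
    hR.eventually (eventually_gt_nhds hr)
  have h2 : ∀ᶠ y in 𝓝 ψ, y ≠ 0 := eventually_ne_nhds hψ0
  have hPt : Tendsto P (𝓝 ψ) (𝓝 ψ) := by
    have h := hPc.continuousAt (x := ψ)
    rwa [ContinuousAt, hPψ] at h
  have h3 : ∀ᶠ d in 𝓝 ψ, r < RCLike.re ⟪P d, T (P d)⟫_𝕜 / ‖P d‖ ^ 2 ∧ P d ≠ 0 :=
    hPt.eventually (h1.and h2)
  obtain ⟨d, hdD, hd⟩ := hD.inter_nhds_nonempty h3
  exact ⟨P d, hPmem d hdD, hd.2, hPorth d, hd.1⟩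

/-- **Rayleigh quotients on `Ω^⊥` are bounded by the min–max level over a dense subspace.**
With `T` symmetric, every Rayleigh quotient `≤ λ₀`, `‖Ω‖ = 1`, `T Ω = λ₀ Ω` and `D` dense:
`re ⟪x, T x⟫ ≤ λ₁(D) ‖x‖²` for all `x ⊥ Ω`, where
`λ₁(D) = inf_{φ ∈ D} sup {re ⟪ψ, T ψ⟫ / ‖ψ‖² : ψ ∈ D ∖ {0}, ψ ⊥ φ}`: for each `φ ∈ D` the trial
vector of `exists_trial_vector_of_inner_eq_zero` is approximated inside `D ∩ φ^⊥`
(`exists_mem_rayleigh_gt`), and the inner suprema are over sets bounded above by `λ₀`.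
(Reed–Simon IV, Thm XIII.1, the inequality `μ₁ ≥ ⋯` of its proof, with trial vectors in a
core.) [cite: ReedSimonIV1978, Thm XIII.1] -/
theorem re_inner_le_secondLevel_mul {T : G →L[𝕜] G} (hT : (T : G →ₗ[𝕜] G).IsSymmetric)
    {lam₀ : ℝ} (hle : ∀ x : G, RCLike.re ⟪x, T x⟫_𝕜 ≤ lam₀ * ‖x‖ ^ 2) {Ω : G} (hΩ : ‖Ω‖ = 1)
    (hTΩ : T Ω = (lam₀ : 𝕜) • Ω) {D : Submodule 𝕜 G} (hD : Dense (D : Set G)) {x : G}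
    (hx : ⟪Ω, x⟫_𝕜 = 0) :
    RCLike.re ⟪x, T x⟫_𝕜 ≤
      sInf ((fun φ : G => sSup ((fun ψ : G => RCLike.re ⟪ψ, T ψ⟫_𝕜 / ‖ψ‖ ^ 2) ''
          {ψ | ψ ∈ D ∧ ψ ≠ 0 ∧ ⟪φ, ψ⟫_𝕜 = 0})) '' (D : Set G)) * ‖x‖ ^ 2 := by
  rcases eq_or_ne x 0 with rfl | hx0
  · simp
  have hB : 0 < ‖x‖ ^ 2 := by positivity
  rw [← div_le_iff₀ hB]
  refine le_csInf ⟨_, 0, D.zero_mem, rfl⟩ ?_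
  rintro _ ⟨φ, hφ, rfl⟩
  obtain ⟨ψ, hψ0, hφψ, hRψ⟩ := exists_trial_vector_of_inner_eq_zero hT hle hΩ hTΩ φ hx hx0
  refine le_of_forall_lt fun r hr => ?_
  obtain ⟨ψ', hψ'D, hψ'0, hφψ', hr'⟩ :=
    exists_mem_rayleigh_gt T hD hφ hψ0 hφψ (hr.trans_le hRψ)
  refine hr'.trans_le (le_csSup ⟨lam₀, ?_⟩ ⟨ψ', ⟨hψ'D, hψ'0, hφψ'⟩, rfl⟩)
  rintro _ ⟨χ, ⟨-, hχ0, -⟩, rfl⟩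
  have hχ : 0 < ‖χ‖ ^ 2 := by positivity
  exact (div_le_iff₀ hχ).mpr (hle χ)

end Helpers

/-- **The second min–max level over a dense subspace bounds `T` on `Ω^⊥`** (Courant–Fischer /
min–max principle, level `1`, the direction that needs no compactness). Let `T` be a bounded
self-adjoint operator on a Hilbert space with `0 ≤ re ⟪x, T x⟫ ≤ λ₀ ‖x‖²`, `Ω` a unit vector
with `T Ω = λ₀ Ω`, and `D` a dense subspace. Then for every `w ⊥ Ω`,
`‖T w‖ ≤ λ₁(D) ‖w‖` with
`λ₁(D) = inf_{φ ∈ D} sup {re ⟪ψ, T ψ⟫ / ‖ψ‖² : ψ ∈ D, ψ ≠ 0, ⟪φ, ψ⟫ = 0}`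
(`Ω^⊥` is invariant, the Rayleigh quotient on `Ω^⊥` is `≤ λ₁(D)` by
`re_inner_le_secondLevel_mul`, and a positive operator with quadratic form `≤ L` at `w` and `T w`
has `‖T w‖ ≤ L ‖w‖`). [cite: ReedSimonIV1978, Thm XIII.1] -/
theorem norm_apply_le_secondLevel_of_dense : ∀ {𝕜 : Type*} [RCLike 𝕜] {G : Type*}
    [NormedAddCommGroup G] [InnerProductSpace 𝕜 G] [CompleteSpace G] (T : G →L[𝕜] G),
    IsSelfAdjoint T → (∀ x : G, 0 ≤ RCLike.re ⟪x, T x⟫_𝕜) → ∀ (lam₀ : ℝ),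
    (∀ x : G, RCLike.re ⟪x, T x⟫_𝕜 ≤ lam₀ * ‖x‖ ^ 2) → ∀ (Ω : G), ‖Ω‖ = 1 →
    T Ω = (lam₀ : 𝕜) • Ω → ∀ (D : Submodule 𝕜 G), Dense (D : Set G) → ∀ w : G, ⟪Ω, w⟫_𝕜 = 0 →
      ‖T w‖ ≤ sInf ((fun φ : G => sSup ((fun ψ : G => RCLike.re ⟪ψ, T ψ⟫_𝕜 / ‖ψ‖ ^ 2) ''
          {ψ | ψ ∈ D ∧ ψ ≠ 0 ∧ ⟪φ, ψ⟫_𝕜 = 0})) '' (D : Set G)) * ‖w‖ := by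
  intro 𝕜 _ G _ _ _ T hT hpos lam₀ hle Ω hΩ hTΩ D hD w hw
  have hsymm := hT.isSymmetric
  have hTw : ⟪Ω, T w⟫_𝕜 = 0 := inner_apply_eq_zero_of_apply_eq_smul hsymm hTΩ hw
  exact norm_apply_le_of_re_inner_le hsymm hpos (re_inner_le_secondLevel_mul hsymm hle hΩ hTΩ hD hw)
    (re_inner_le_secondLevel_mul hsymm hle hΩ hTΩ hD hTw)

end Literature.Analysis.OperatorTheory
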